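import Summits.RiemannHypothesis.RiemannHypothesis.Theorems.PfPersistenceCoefficientRigiditySymbol
import HarnessLib

/-!
# Coefficient rigidity of window positivity, VIII-d: no shielding without an origin atom
(pub-rhpf cand-7, gen 9; mechanism/rigidity campaign; no RH claims)

A consequence of the symbol criterion (part VIII-b), completing parts IV-b (distinct positive
sites) and VIII-c (shielding by the origin): for a finitely supported even perturbation
`∑_{i ∈ E} c_i (δ_{x_i} + δ_{-x_i})` of `ζ`'s explicit-formula measure whose sites are ALL
NONZERO (repetitions and `±` pairs allowed), group the coefficients by `|x_i|`:
`C_v = ∑_{|x_i| = v} c_i`.  Then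

* `multiSiteQuadratic_nonneg_iff_of_ne_zero` — positivity on the test class
  `↔ RiemannHypothesis ∧ ∀ v, C_v = 0`;
* `multiSiteQuadratic_eq_weilQuadratic_of_grouped_eq_zero` — and `∀ v, C_v = 0` means the
  perturbation is INVISIBLE (`Q_{E,c,x} = W` on all test functions).

So a finite even perturbation avoiding the origin preserves window positivity (under RH) only if
it is the zero perturbation: defects can be shielded by an origin atom (VIII-c) and by nothing
else of finite support.  RH is NOT claimed.  ALL STATEMENTS ARE PROVED (no `sorry`, no new
axioms); no sentence is DATA.

References: E. Bombieri, Rend. Lincei (9) 11 (2000) 183–233, Thm. 1; A. E. Ingham / Fejér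
(positivity of cosine sums, via part IV-a).
-/

set_option linter.dupNamespace false

noncomputable section

open Complex Filter Set MeasureTheory
open scoped Real Topology ComplexConjugate NNReal

namespace Summit.RiemannHypothesis.RiemannHypothesis.Theorems.PfPersistenceCoefficientRigidity

open Literature.NumberTheory.LFunctions
open Literature.NumberTheory.LFunctions.WeilConverse
open Summit.RiemannHypothesis.RiemannHypothesis.Theorems.PfPersistenceDownCone
open Summit.RiemannHypothesis.RiemannHypothesis.Theorems.PfPersistenceBarrier

/-! ## §54 Grouping the symbol by `|x_i|` -/

/-- The symbol grouped by absolute site: `P(t) = ∑_{v ∈ |x|(E)} C_v cos(t v)` with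
`C_v = ∑_{i ∈ E, |x_i| = v} c_i`. [this work] -/
theorem siteSymbol_eq_sum_image_abs {ι : Type*} [DecidableEq ι] (E : Finset ι) (c x : ι → ℝ)
    (t : ℝ) :
    siteSymbol E c x t =
      ∑ v ∈ E.image (fun i ↦ |x i|), (∑ i ∈ E with |x i| = v, c i) * Real.cos (t * v) := by
  rw [siteSymbol, ← Finset.sum_fiberwise_of_maps_to (s := E) (t := E.image (fun i ↦ |x i|))
    (g := fun i ↦ |x i|) (fun i hi ↦ Finset.mem_image_of_mem _ hi)]
  refine Finset.sum_congr rfl fun v _ ↦ ?_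
  rw [Finset.sum_mul]
  refine Finset.sum_congr rfl fun i hi ↦ ?_
  rw [← (Finset.mem_filter.1 hi).2]
  rcases abs_choice (x i) with h | h
  · rw [h]
  · rw [h, mul_neg, Real.cos_neg]

/-- With all sites nonzero: `P ≥ 0` everywhere iff every grouped coefficient vanishes.
[this work] -/
theorem forall_siteSymbol_nonneg_iff_of_ne_zero {ι : Type*} [DecidableEq ι] (E : Finset ι)
    (c x : ι → ℝ) (hx : ∀ i ∈ E, x i ≠ 0) :
    (∀ t, 0 ≤ siteSymbol E c x t) ↔
      ∀ v : ℝ, ∑ i ∈ E with |x i| = v, c i = 0 := by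
  constructor
  · intro h
    by_contra hne
    push Not at hne
    obtain ⟨v₀, hv₀⟩ := hne
    have hv₀mem : v₀ ∈ E.image (fun i ↦ |x i|) := by
      by_contra hmem
      apply hv₀
      refine Finset.sum_eq_zero fun i hi ↦ ?_
      exact absurd (Finset.mem_image.2 ⟨i, (Finset.mem_filter.1 hi).1, (Finset.mem_filter.1 hi).2⟩)
        hmem
    have hpos : ∀ v ∈ E.image (fun i ↦ |x i|), 0 < id v := by
      intro v hv
      obtain ⟨i, hi, rfl⟩ := Finset.mem_image.1 hv
      exact abs_pos.2 (hx i hi)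
    obtain ⟨t, ht⟩ := exists_trigSum_neg (E := E.image (fun i ↦ |x i|))
      (c := fun v ↦ ∑ i ∈ E with |x i| = v, c i) (x := id) hpos (Set.injOn_id _)
      ⟨v₀, hv₀mem, hv₀⟩
    have h1 := h t
    rw [siteSymbol_eq_sum_image_abs] at h1
    simp only [id] at ht
    linarith
  · intro h t
    rw [siteSymbol_eq_sum_image_abs]
    simp [h]

/-! ## §55 No shielding without an origin atom -/

/-- **No shielding without an origin atom.**  If all sites are nonzero, the perturbed form
`W + ∑ c_i (δ_{x_i} + δ_{-x_i})` is positive on the test class iff RH holds and every grouped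
coefficient `C_v = ∑_{|x_i| = v} c_i` vanishes. (RH is NOT claimed.) [this work] -/
theorem multiSiteQuadratic_nonneg_iff_of_ne_zero {ι : Type*} [DecidableEq ι] (E : Finset ι)
    (c x : ι → ℝ) (hx : ∀ i ∈ E, x i ≠ 0) :
    (∀ g : ℝ → ℂ, IsWeilTest g → 0 ≤ (multiSiteQuadratic E c x g).re) ↔
      RiemannHypothesis ∧ ∀ v : ℝ, ∑ i ∈ E with |x i| = v, c i = 0 := by
  rw [multiSiteQuadratic_nonneg_iff_symbol, forall_siteSymbol_nonneg_iff_of_ne_zero E c x hx]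

/-- The site functional grouped by absolute site. [this work] -/
theorem siteSum_eq_sum_image_abs {ι : Type*} [DecidableEq ι] (E : Finset ι) (c x : ι → ℝ)
    (k : ℝ → ℂ) :
    ∑ i ∈ E, (c i : ℂ) * (k (x i) + k (-(x i))) =
      ∑ v ∈ E.image (fun i ↦ |x i|),
        ((∑ i ∈ E with |x i| = v, c i : ℝ) : ℂ) * (k v + k (-v)) := by
  rw [← Finset.sum_fiberwise_of_maps_to (s := E) (t := E.image (fun i ↦ |x i|))
    (g := fun i ↦ |x i|) (fun i hi ↦ Finset.mem_image_of_mem _ hi)]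
  refine Finset.sum_congr rfl fun v _ ↦ ?_
  push_cast
  rw [Finset.sum_mul]
  refine Finset.sum_congr rfl fun i hi ↦ ?_
  rw [← (Finset.mem_filter.1 hi).2]
  rcases abs_choice (x i) with h | h
  · rw [h]
  · rw [h, neg_neg, add_comm]

/-- **Vanishing grouped coefficients = invisible perturbation**: then `Q_{E,c,x}(g) = W(g ⋆ g̃)`
for every `g`. [this work] -/
theorem multiSiteQuadratic_eq_weilQuadratic_of_grouped_eq_zero {ι : Type*} [DecidableEq ι]
    {E : Finset ι} {c x : ι → ℝ} (h : ∀ v : ℝ, ∑ i ∈ E with |x i| = v, c i = 0) (g : ℝ → ℂ) :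
    multiSiteQuadratic E c x g = weilQuadratic g := by
  rw [multiSiteQuadratic, siteSum_eq_sum_image_abs]
  simp [h]

/-- Hence, with all sites nonzero: positivity on the test class iff RH and the perturbation is
invisible. [this work] -/
theorem multiSiteQuadratic_nonneg_iff_invisible {ι : Type*} [DecidableEq ι] (E : Finset ι)
    (c x : ι → ℝ) (hx : ∀ i ∈ E, x i ≠ 0) :
    (∀ g : ℝ → ℂ, IsWeilTest g → 0 ≤ (multiSiteQuadratic E c x g).re) ↔
      RiemannHypothesis ∧ ∀ g : ℝ → ℂ, multiSiteQuadratic E c x g = weilQuadratic g := by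
  rw [multiSiteQuadratic_nonneg_iff_of_ne_zero E c x hx]
  refine and_congr_right fun hRH ↦ ⟨fun h g ↦
    multiSiteQuadratic_eq_weilQuadratic_of_grouped_eq_zero h g, fun h ↦ ?_⟩
  rw [← forall_siteSymbol_nonneg_iff_of_ne_zero E c x hx]
  have hpos := ((multiSiteQuadratic_nonneg_iff_symbol E c x).2
    ⟨hRH, ?_⟩)
  · exact ((multiSiteQuadratic_nonneg_iff_symbol E c x).1 hpos).2
  · -- positivity of `Q = W` under RH gives the symbol condition back
    have hW : ∀ g : ℝ → ℂ, IsWeilTest g → 0 ≤ (multiSiteQuadratic E c x g).re := fun g hg ↦ by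
      rw [h g, ← siteQuadratic_zero 0 g]
      exact (siteQuadratic_zero_nonneg_iff_riemannHypothesis 0).2 hRH g hg
    exact ((multiSiteQuadratic_nonneg_iff_symbol E c x).1 hW).2

end Summit.RiemannHypothesis.RiemannHypothesis.Theorems.PfPersistenceCoefficientRigidity

end
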